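import Mathlib
import Literature.Geometry.DiscreteGeometry.TwoShellPatterns
import Literature.MathematicalPhysics.StatisticalMechanics.BarlowStacking
import Summits.AtomisticToContinuum.Crystallization.Theorems.NashClassCertificatesNashNearFieldStubChartCoreAssembly

/-!
# Crux `NashClassCertificates.NashNearField` (stmt-AtomisticToContinuum-16827), line `birth`,
# stub `stub_chartCore` — part 2b: the assembly from a LABELLED placement (weakest metric demands)

Companion of `…StubChartCoreAssembly` (`stub_chartCore_of_placement`), which derives `stub_chartCore`
from a per-pivot placement of ALL eighteen pattern particles of each neighbour within `2/5` of template
sites.  The certified placement constants of the twin line (lead c3 of stmt-13958: `≤ 0.3585·a` for labels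
whose site can meet the `2`-ball, `≤ 0.345·a` for sites of norm `≤ 43/20`) do not cover the FAR labels of a
pivot (sites up to `√2 + √2` from the centre), so this file records the sharper reduction
`stub_chartCore_of_labelled_placement`: per pivot `v ∈ P` (neighbour `f v` with one goodness witness
`(a', A', P', f')`) it suffices to give a LABELLING of the pattern `P'` by template sites
`w ↦ b_w = barlowPos 1 (√6/3) s (σm w) (σu w) (σw w)` which is

* adjacent: `R b_w ≠ v`, `dist (R b_w) v ≤ 3/2`;
* injective on `P'` (a combinatorial fact for the intended exact label bijection — no metric input);
* metric ONLY WHERE NEEDED: `dist (x (f' w)) (x i + a • A (R b_w)) ≤ 2/5` whenever `‖b_w‖ ≤ 43/20` or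
  `dist (x (f' w)) (x i) ≤ 2`.

Clause (iii) of the stub then follows from the neighbour's completeness (a particle within
`141/100 ≤ 3a'/2` of `x (f v)` is `f v` or some `f' w`, and it is within `2` of `x i` by hypothesis), and
clause (iv) from the counting lemma of part 2 (`exists_eq_of_injOn_central`: an injective map of the
18-point pattern into the non-zero central sites of the re-centred template `barlowPos (s (· + m₀))` is onto),
the metric clause being invoked only at the prescribed site, of norm `≤ 43/20`.
-/

noncomputable section

open Literature.MathematicalPhysics.StatisticalMechanics Literature.Geometry.DiscreteGeometry

namespace Summit.AtomisticToContinuum.Crystallization.Theorems.NashClassCertificatesNashNearField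

/-- **`stub_chartCore` from a labelled placement.**  See the module docstring: per pivot, an adjacent,
injective site labelling of the neighbour's pattern, metrically accurate (`2/5`) on the labels whose site has
norm `≤ 43/20` or whose particle lies within `2` of the centre, gives `stub_chartCore`. -/
theorem stub_chartCore_of_labelled_placement
    (hpl : ∀ (N : ℕ) (x : Fin N → EuclideanSpace ℝ (Fin 3)) (i : Fin N),
      (∀ k : Fin N, dist (x k) (x i) ≤ 3 → IsTwoShellGood (1 / 20) (47 / 50) 1 x k) →
      ∀ (a : ℝ) (A : EuclideanSpace ℝ (Fin 3) →ₗᵢ[ℝ] EuclideanSpace ℝ (Fin 3)) (P : Finset (EuclideanSpace ℝ (Fin 3)))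
        (f : EuclideanSpace ℝ (Fin 3) → Fin N),
        47 / 50 ≤ a → a ≤ 1 → (P = fccTwoShellPattern ∨ P = hcpTwoShellPattern) →
        (∀ v ∈ P, f v ≠ i ∧ dist (x (f v)) (x i + a • A v) ≤ 1 / 20 * a) → Set.InjOn f ↑P →
        (∀ j : Fin N, j ≠ i → dist (x j) (x i) ≤ 3 / 2 * a → ∃ v ∈ P, f v = j) →
        ∃ (R : EuclideanSpace ℝ (Fin 3) →ₗᵢ[ℝ] EuclideanSpace ℝ (Fin 3)) (s : ℤ → ℤ), IsHaggSeq s ∧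
          (∀ v ∈ P, ∃ m u w : ℤ, R (barlowPos 1 (Real.sqrt 6 / 3) s m u w) = v) ∧
          (∀ m u w : ℤ, ‖barlowPos 1 (Real.sqrt 6 / 3) s m u w‖ ≤ 3 / 2 → barlowPos 1 (Real.sqrt 6 / 3) s m u w ≠ 0 →
            R (barlowPos 1 (Real.sqrt 6 / 3) s m u w) ∈ P) ∧
          (∀ v ∈ P, ∃ (a' : ℝ) (A' : EuclideanSpace ℝ (Fin 3) →ₗᵢ[ℝ] EuclideanSpace ℝ (Fin 3))
            (P' : Finset (EuclideanSpace ℝ (Fin 3))) (f' : EuclideanSpace ℝ (Fin 3) → Fin N)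
            (σm σu σw : EuclideanSpace ℝ (Fin 3) → ℤ),
            47 / 50 ≤ a' ∧ a' ≤ 1 ∧ (P' = fccTwoShellPattern ∨ P' = hcpTwoShellPattern) ∧
            (∀ w ∈ P', f' w ≠ f v ∧ dist (x (f' w)) (x (f v) + a' • A' w) ≤ 1 / 20 * a') ∧ Set.InjOn f' ↑P' ∧
            (∀ k : Fin N, k ≠ f v → dist (x k) (x (f v)) ≤ 3 / 2 * a' → ∃ w ∈ P', f' w = k) ∧
            Set.InjOn (fun w => barlowPos 1 (Real.sqrt 6 / 3) s (σm w) (σu w) (σw w)) ↑P' ∧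
            (∀ w ∈ P', R (barlowPos 1 (Real.sqrt 6 / 3) s (σm w) (σu w) (σw w)) ≠ v ∧
              dist (R (barlowPos 1 (Real.sqrt 6 / 3) s (σm w) (σu w) (σw w))) v ≤ 3 / 2 ∧
              ((‖barlowPos 1 (Real.sqrt 6 / 3) s (σm w) (σu w) (σw w)‖ ≤ 43 / 20 ∨ dist (x (f' w)) (x i) ≤ 2) →
                dist (x (f' w)) (x i + a • A (R (barlowPos 1 (Real.sqrt 6 / 3) s (σm w) (σu w) (σw w)))) ≤ 2 / 5)))) :
    ∀ (N : ℕ) (x : Fin N → EuclideanSpace ℝ (Fin 3)) (i : Fin N),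
      (∀ k : Fin N, dist (x k) (x i) ≤ 3 → IsTwoShellGood (1 / 20) (47 / 50) 1 x k) →
      ∀ (a : ℝ) (A : EuclideanSpace ℝ (Fin 3) →ₗᵢ[ℝ] EuclideanSpace ℝ (Fin 3)) (P : Finset (EuclideanSpace ℝ (Fin 3))) (f : EuclideanSpace ℝ (Fin 3) → Fin N),
        47 / 50 ≤ a → a ≤ 1 → (P = fccTwoShellPattern ∨ P = hcpTwoShellPattern) →
        (∀ v ∈ P, f v ≠ i ∧ dist (x (f v)) (x i + a • A v) ≤ 1 / 20 * a) → Set.InjOn f ↑P →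
        (∀ j : Fin N, j ≠ i → dist (x j) (x i) ≤ 3 / 2 * a → ∃ v ∈ P, f v = j) →
        ∃ (R : EuclideanSpace ℝ (Fin 3) →ₗᵢ[ℝ] EuclideanSpace ℝ (Fin 3)) (s : ℤ → ℤ), IsHaggSeq s ∧
          (∀ v ∈ P, ∃ m u w : ℤ, R (barlowPos 1 (Real.sqrt 6 / 3) s m u w) = v) ∧
          (∀ m u w : ℤ, ‖barlowPos 1 (Real.sqrt 6 / 3) s m u w‖ ≤ 3 / 2 → barlowPos 1 (Real.sqrt 6 / 3) s m u w ≠ 0 → R (barlowPos 1 (Real.sqrt 6 / 3) s m u w) ∈ P) ∧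
          (∀ v ∈ P, ∀ k : Fin N, dist (x k) (x (f v)) ≤ 141 / 100 → dist (x k) (x i) ≤ 2 →
            ∃ m u w : ℤ, dist (x k) (x i + a • A (R (barlowPos 1 (Real.sqrt 6 / 3) s m u w))) ≤ 2 / 5) ∧
          (∀ v ∈ P, ∀ m u w : ℤ, ‖barlowPos 1 (Real.sqrt 6 / 3) s m u w‖ ≤ 43 / 20 → dist (R (barlowPos 1 (Real.sqrt 6 / 3) s m u w)) v ≤ 3 / 2 →
            ∃ k : Fin N, dist (x k) (x i + a • A (R (barlowPos 1 (Real.sqrt 6 / 3) s m u w))) ≤ 2 / 5) := by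
  intro N x i hgood a A P f ha1 ha2 hP hf hinj hcomp
  obtain ⟨R, s, hs, h1, h2, hpiv⟩ := hpl N x i hgood a A P f ha1 ha2 hP hf hinj hcomp
  refine ⟨R, s, hs, h1, h2, fun v hv k hk1 hk2 => ?_, fun v hv m u w hbn hdist => ?_⟩
  · -- (iii)
    obtain ⟨a', A', P', f', σm, σu, σw, ha1', -, -, -, -, hcomp', -, hplace⟩ := hpiv v hv
    by_cases hkj : k = f v
    · subst hkj
      obtain ⟨m, u, w, hR⟩ := h1 v hv
      refine ⟨m, u, w, ?_⟩
      rw [hR]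
      calc dist (x (f v)) (x i + a • A v) ≤ 1 / 20 * a := (hf v hv).2
        _ ≤ 2 / 5 := by linarith
    · have hk' : dist (x k) (x (f v)) ≤ 3 / 2 * a' := hk1.trans (by linarith)
      obtain ⟨w, hw, rfl⟩ := hcomp' k hkj hk'
      obtain ⟨-, -, hd⟩ := hplace w hw
      exact ⟨σm w, σu w, σw w, hd (Or.inr hk2)⟩
  · -- (iv)
    obtain ⟨a', A', P', f', σm, σu, σw, -, -, hP', -, -, -, hσinj, hplace⟩ := hpiv v hv
    by_cases hbv : R (barlowPos 1 (Real.sqrt 6 / 3) s m u w) = v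
    · refine ⟨f v, ?_⟩
      rw [hbv]
      calc dist (x (f v)) (x i + a • A v) ≤ 1 / 20 * a := (hf v hv).2
        _ ≤ 2 / 5 := by linarith
    · obtain ⟨m₀, u₀, w₀, hv0⟩ := h1 v hv
      set s' : ℤ → ℤ := fun k => s (k + m₀) with hs'def
      have hs' : IsHaggSeq s' := isHaggSeq_shift hs m₀
      set v0 := barlowPos 1 (Real.sqrt 6 / 3) s m₀ u₀ w₀ with hv0def
      set g : EuclideanSpace ℝ (Fin 3) → EuclideanSpace ℝ (Fin 3) :=
        fun w' => barlowPos 1 (Real.sqrt 6 / 3) s (σm w') (σu w') (σw w') - v0 with hgdef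
      have hgsite : ∀ w' ∈ P', (∃ m u w₁ : ℤ, g w' = barlowPos 1 (Real.sqrt 6 / 3) s' m u w₁) ∧ g w' ≠ 0 ∧
          ‖g w'‖ ≤ 3 / 2 := by
        intro w' hw'
        obtain ⟨hne, hle, -⟩ := hplace w' hw'
        refine ⟨⟨σm w' - m₀, σu w' - u₀, σw w' - w₀, barlowPos_sub_barlowPos _ _ _ _ _ _ _ _ _⟩, ?_, ?_⟩
        · intro h0
          apply hne
          rw [hgdef] at h0
          simp only at h0
          rw [sub_eq_zero] at h0
          rw [h0, ← hv0]
        · rw [hgdef]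
          simp only
          rw [← dist_eq_norm, ← R.dist_map, hv0]
          exact hle
      have hginj : Set.InjOn g ↑P' := by
        intro w' hw' w₂ hw₂ heq
        have heq' : barlowPos 1 (Real.sqrt 6 / 3) s (σm w') (σu w') (σw w') =
            barlowPos 1 (Real.sqrt 6 / 3) s (σm w₂) (σu w₂) (σw w₂) := by
          simpa [hgdef] using heq
        exact hσinj hw' hw₂ heq'
      have hb : barlowPos 1 (Real.sqrt 6 / 3) s m u w - v0 =
          barlowPos 1 (Real.sqrt 6 / 3) s' (m - m₀) (u - u₀) (w - w₀) :=
        barlowPos_sub_barlowPos _ _ _ _ _ _ _ _ _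
      have hb0 : barlowPos 1 (Real.sqrt 6 / 3) s' (m - m₀) (u - u₀) (w - w₀) ≠ 0 := by
        rw [← hb, sub_ne_zero]
        intro h0
        exact hbv (by rw [h0, hv0])
      have hble : ‖barlowPos 1 (Real.sqrt 6 / 3) s' (m - m₀) (u - u₀) (w - w₀)‖ ≤ 3 / 2 := by
        rw [← hb, ← dist_eq_norm, ← R.dist_map, hv0]
        exact hdist
      obtain ⟨w', hw', hgw⟩ := exists_eq_of_injOn_central hs' (card_eq_eighteen_of_twoShellPattern hP')
        hgsite hginj hb0 hble
      refine ⟨f' w', ?_⟩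
      obtain ⟨-, -, hd⟩ := hplace w' hw'
      have heq : barlowPos 1 (Real.sqrt 6 / 3) s (σm w') (σu w') (σw w') = barlowPos 1 (Real.sqrt 6 / 3) s m u w := by
        rw [← hb, hgdef] at hgw
        simpa using hgw
      rw [heq] at hd
      exact hd (Or.inl hbn)

/-- **Registered sub-goal `stub_chartCoreAssemblyWeak` of crux stmt-AtomisticToContinuum-16827** (the reduction of
`stub_chartCore` to a labelled placement): landing anchor of this file, re-exporting
`stub_chartCore_of_labelled_placement`. -/
theorem stub_chartCoreAssemblyWeak : (∀ (N : ℕ) (x : Fin N → EuclideanSpace ℝ (Fin 3)) (i : Fin N), (∀ k : Fin N, dist (x k) (x i) ≤ 3 → IsTwoShellGood (1 / 20) (47 / 50) 1 x k) → ∀ (a : ℝ) (A : EuclideanSpace ℝ (Fin 3) →ₗᵢ[ℝ] EuclideanSpace ℝ (Fin 3)) (P : Finset (EuclideanSpace ℝ (Fin 3))) (f : EuclideanSpace ℝ (Fin 3) → Fin N), 47 / 50 ≤ a → a ≤ 1 → (P = fccTwoShellPattern ∨ P = hcpTwoShellPattern) → (∀ v ∈ P, f v ≠ i ∧ dist (x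 (f v)) (x i + a • A v) ≤ 1 / 20 * a) → Set.InjOn f ↑P → (∀ j : Fin N, j ≠ i → dist (x j) (x i) ≤ 3 / 2 * a → ∃ v ∈ P, f v = j) → ∃ (R : EuclideanSpace ℝ (Fin 3) →ₗᵢ[ℝ] EuclideanSpace ℝ (Fin 3)) (s : ℤ → ℤ), IsHaggSeq s ∧ (∀ v ∈ P, ∃ m u w : ℤ, R (barlowPos 1 (Real.sqrt 6 / 3) s m u w) = v) ∧ (∀ m u w : ℤ, ‖barlowPos 1 (Real.sqrt 6 / 3) s m u w‖ ≤ 3 / 2 → barlowPos 1 (Real.sqrt 6 / 3) s m u w ≠ 0 → R (barlowPos 1 (Real.sqrt 6 / 3) s m u w) ∈ P) ∧ (∀ v ∈ P, ∃ (a' : ℝ) (A' : EuclideanSpace ℝ (Fin 3) →ₗᵢ[ℝ] EuclideanSpace ℝ (Fin 3)) (P' : Finset (EuclideanSpace ℝ (Fin 3))) (f' : EuclideanSpace ℝ (Fin 3) → Fin N) (σm σu σw : EuclideanSpace ℝ (Fin 3) → ℤ), 47 / 50 ≤ a' ∧ a' ≤ 1 ∧ (P' = fccTwoShellPattern ∨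 P' = hcpTwoShellPattern) ∧ (∀ w ∈ P', f' w ≠ f v ∧ dist (x (f' w)) (x (f v) + a' • A' w) ≤ 1 / 20 * a') ∧ Set.InjOn f' ↑P' ∧ (∀ k : Fin N, k ≠ f v → dist (x k) (x (f v)) ≤ 3 / 2 * a' → ∃ w ∈ P', f' w = k) ∧ Set.InjOn (fun w => barlowPos 1 (Real.sqrt 6 / 3) s (σm w) (σu w) (σw w)) ↑P' ∧ (∀ w ∈ P', R (barlowPos 1 (Real.sqrt 6 / 3) s (σm w) (σu w) (σw w)) ≠ v ∧ dist (R (barlowPos 1 (Real.sqrt 6 / 3) s (σm w) (σu w) (σw w))) v ≤ 3 / 2 ∧ ((‖barlowPos 1 (Real.sqrt 6 / 3) s (σm w) (σu w) (σw w)‖ ≤ 43 / 20 ∨ dist (x (f' w)) (x i) ≤ 2) → dist (x (f' w)) (x i + a • A (R (barlowPos 1 (Real.sqrt 6 / 3) s (σm w) (σu w) (σw w)))) ≤ 2 / 5)))) → ∀ (N : ℕ) (x : Fin N → EuclideanSpace ℝ (Fin 3)) (i : Fin N), (∀ k : Fin N, dist (x k) (x i) ≤ 3 → IsTwoShellGood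 (1 / 20) (47 / 50) 1 x k) → ∀ (a : ℝ) (A : EuclideanSpace ℝ (Fin 3) →ₗᵢ[ℝ] EuclideanSpace ℝ (Fin 3)) (P : Finset (EuclideanSpace ℝ (Fin 3))) (f : EuclideanSpace ℝ (Fin 3) → Fin N), 47 / 50 ≤ a → a ≤ 1 → (P = fccTwoShellPattern ∨ P = hcpTwoShellPattern) → (∀ v ∈ P, f v ≠ i ∧ dist (x (f v)) (x i + a • A v) ≤ 1 / 20 * a) → Set.InjOn f ↑P → (∀ j : Fin N, j ≠ i → dist (x j) (x i) ≤ 3 / 2 * a → ∃ v ∈ P, f v = j) → ∃ (R : EuclideanSpace ℝ (Fin 3) →ₗᵢ[ℝ] EuclideanSpace ℝ (Fin 3)) (s : ℤ → ℤ), IsHaggSeq s ∧ (∀ v ∈ P, ∃ m u w : ℤ, R (barlowPos 1 (Real.sqrt 6 / 3) s m u w) = v) ∧ (∀ m u w : ℤ, ‖barlowPos 1 (Real.sqrt 6 / 3) s m u w‖ ≤ 3 / 2 → barlowPos 1 (Real.sqrt 6 / 3) s m u w ≠ 0 → R (barlowPos 1 (Real.sqrt 6 / 3) s m u w) ∈ P)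 ∧ (∀ v ∈ P, ∀ k : Fin N, dist (x k) (x (f v)) ≤ 141 / 100 → dist (x k) (x i) ≤ 2 → ∃ m u w : ℤ, dist (x k) (x i + a • A (R (barlowPos 1 (Real.sqrt 6 / 3) s m u w))) ≤ 2 / 5) ∧ (∀ v ∈ P, ∀ m u w : ℤ, ‖barlowPos 1 (Real.sqrt 6 / 3) s m u w‖ ≤ 43 / 20 → dist (R (barlowPos 1 (Real.sqrt 6 / 3) s m u w)) v ≤ 3 / 2 → ∃ k : Fin N, dist (x k) (x i + a • A (R (barlowPos 1 (Real.sqrt 6 / 3) s m u w))) ≤ 2 / 5) :=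
  stub_chartCore_of_labelled_placement

end Summit.AtomisticToContinuum.Crystallization.Theorems.NashClassCertificatesNashNearField

end
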